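import Literature.Analysis.FluidPDE.CorrectorFourierRegularity
import Literature.Analysis.FluidPDE.ScalarFourierTimeRegularity
import HarnessLib

/-!
# Time regularity of the Fourier-side solution of (3.2): the mild equation differentiated, families of all orders

Analysis/FluidPDE proof file, sixth of the files discharging
`Literature.Analysis.FluidPDE.Torus.CheskidovLuo2022LocalExistence` (objects in
`CorrectorFourierDefs`; Picard iteration in `CorrectorFourierPicard`, all-orders decay in
`CorrectorFourierRegularity`). The series twin of `ScalarFourierTimeRegularity` for the
vector-valued, Leray-projected system:

* `DataHyp.hasDerivWithinAt_picardLim` — **mild ⇒ differential**: on `[0, θ]` the Picard limit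
  satisfies `∂ₜ c(l,t,k) = -4π²|k|² c(l,t,k) - (P G)(U(t), RH(t), c(t))(l,k)` as a derivative
  within `[0, θ]` (product rule and the fundamental theorem of calculus on
  `c = -e^{-νt}∫₀ᵗ e^{νs}(P G)(s) ds`);
* `IsCoeffFamily.projFamily`, `IsCoeffFamily.bootRHS'` — closure of coefficient families
  (`ScalarFourier.IsCoeffFamily`) under the projected convective family and the bootstrap
  right-hand side (Leibniz families of the lattice convolutions,
  `ScalarFourier.IsCoeffFamily.transportFamily`; the Leray entries are bounded time-independent
  symbols);
* `DataHyp.exists_coeffFamily` — **families of all orders**: if the drift and stress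
  coefficients are, on `[0, θ]`, the zeroth members of families of every order (the
  coefficients of `∂ₜⁱuⱼ`, `∂ₜⁱRₗⱼ`), then every component `c l` of the Picard limit starts a
  coefficient family of every order `n` (`∂ₜWᵢ = Wᵢ₊₁` within `[0, θ]`, every decay,
  continuity), by the bootstrap `Wᵢ₊₁ := -4π²|k|² Wᵢ - (P G)ᵢ`.

## References

* A. Cheskidov, X. Luo, arXiv:2009.06596, §3.1 (3.2). [`CheskidovLuo2022`]
* P. G. Lemarié-Rieusset, *The Navier–Stokes problem in the 21st century*, CRC 2016, §8.5
  (equivalence of mild and differential formulations).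
-/

noncomputable section

open MeasureTheory Real Set Filter Topology UnitAddTorus

namespace Literature.Analysis.FluidPDE

namespace CorrectorFourier

open ScalarFourier
open FourierNS (HasDecay clamp)
open Literature.Analysis.FunctionSpaces.Torus (freqNormSq)

variable {d : Type*} [Fintype d] [DecidableEq d]
variable {θ : ℝ} {U : d → ℝ → (d → ℤ) → ℂ} {RH : d → d → ℝ → (d → ℤ) → ℂ}

/-! ### Mild ⇒ differential -/

/-- **Mild ⇒ differential.** Under the threshold hypotheses of `CorrectorFourierPicard`, the
Picard limit `c` satisfies at every component `l`, frequency `k` and `t ∈ [0, θ]`: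
`∂ₜ c(l,t,k) = -4π²|k|² c(l,t,k) - (P G)(U(t), RH(t), c(t))(l,k)` within `[0, θ]`
(differentiate `c(t) = -e^{-νt} ∫₀ᵗ e^{νs} (P G)(s) ds`; Lemarié-Rieusset 2016, §8.5). [folklore] -/
theorem DataHyp.hasDerivWithinAt_picardLim (h : DataHyp θ U RH) {ρ A B : ℝ} (hρ : 0 ≤ ρ)
    (hA : 0 ≤ A) (hB : 0 ≤ B) (hU : ∀ j t, HasDecay (latOrder d + 1) A (U j t))
    (hR : ∀ i j t, HasDecay (latOrder d + 1) B (RH i j t))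
    (hS1 : (Real.exp 1 * (1 + 1 / (2 * Real.sqrt (4 * π ^ 2 * 1))) * Real.sqrt θ) *
      (2 * Fintype.card d *
        (Fintype.card d * (2 ^ latOrder d * latMass d * (ρ * (2 * π * ρ) + ρ * (2 * π * ρ))) +
          Fintype.card d * (2 ^ latOrder d * latMass d * (A * (2 * π * ρ) + A * (2 * π * ρ))) +
          Fintype.card d * (2 ^ latOrder d * latMass d * (ρ * (2 * π * A) + ρ * (2 * π * A))) +
          Fintype.card d * (2 * π * B))) ≤ ρ)
    (hS2 : (Real.exp 1 * (1 + 1 / (2 * Real.sqrt (4 * π ^ 2 * 1))) * Real.sqrt θ) *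
      (2 * Fintype.card d *
        (Fintype.card d * (2 ^ latOrder d * latMass d * (2 * π)) * (4 * ρ + 4 * A))) ≤ 1 / 2)
    (l : d) (k : d → ℤ) {t : ℝ} (ht : t ∈ Icc 0 θ) :
    HasDerivWithinAt (fun s => picardLim θ U RH l s k)
      (-(heatRate 1 k : ℂ) * picardLim θ U RH l t k -
        projSym (fun j => U j t) (fun i j => RH i j t) (fun j => picardLim θ U RH j t) l k)
      (Icc 0 θ) t := by
  obtain ⟨-, -, -, -, hlimball⟩ := h.iter_tendsto hρ hA hB hU hR hS1 hS2
  set c := picardLim θ U RH with hc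
  set ν := heatRate 1 k with hν
  have hcc : ∀ l m, Continuous fun t => c l t m := h.continuous_picardLim hρ hA hB hU hR hS1 hS2
  set P : ℝ → ℂ := fun s => -projSym (fun j => U j s) (fun i j => RH i j s) (fun j => c j s) l k with hP
  have hPc : Continuous P :=
    (continuous_projSym_param (Y := ℝ) (fun j m => h.contU j m) (fun i j m => h.contR i j m) hcc
      (fun s j => hU j s) (fun s j => hlimball j s) l k).neg
  -- `G s = ∫₀ˢ e^{νσ} P(σ) dσ` and its derivative
  set G : ℝ → ℂ := fun s => ∫ σ in (0 : ℝ)..s, Real.exp (ν * σ) • P σ with hG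
  have hGi : Continuous fun σ => Real.exp (ν * σ) • P σ := by fun_prop
  have hG' : ∀ s, HasDerivAt G (Real.exp (ν * s) • P s) s := fun s =>
    (hGi.integral_hasStrictDerivAt 0 s).hasDerivAt
  have hE' : ∀ s, HasDerivAt (fun s => Real.exp (-(ν * s))) (-ν * Real.exp (-(ν * s))) s := by
    intro s
    have := ((hasDerivAt_id s).const_mul ν).neg.exp
    simpa [mul_comm] using this
  -- `F s = e^{-νs} G s` is the Duhamel formula (zero datum)
  set F : ℝ → ℂ := fun s => Real.exp (-(ν * s)) • G s with hF
  have hF' : ∀ s, HasDerivAt F (-(ν : ℂ) * F s + P s) s := by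
    intro s
    have h2 : HasDerivAt (fun s => Real.exp (-(ν * s)) • G s)
        (Real.exp (-(ν * s)) • (Real.exp (ν * s) • P s) + (-ν * Real.exp (-(ν * s))) • G s) s :=
      (hE' s).smul (hG' s)
    have hone : Real.exp (-(ν * s)) * Real.exp (ν * s) = 1 := by
      rw [← Real.exp_add]; simp
    have hone' : (Real.exp (-(ν * s)) : ℂ) * (Real.exp (ν * s) : ℂ) = 1 := by
      rw [← Complex.ofReal_mul, hone, Complex.ofReal_one]
    have heq : Real.exp (-(ν * s)) • (Real.exp (ν * s) • P s) + (-ν * Real.exp (-(ν * s))) • G s =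
        -(ν : ℂ) * F s + P s := by
      simp only [hF, Complex.real_smul, Complex.ofReal_mul, Complex.ofReal_neg]
      linear_combination (P s) * hone'
    rw [heq] at h2
    exact h2
  -- on `[0, θ]`, `c l s k = F s`
  have hcF : ∀ s ∈ Icc 0 θ, c l s k = F s := by
    intro s hs
    have hfix := h.picardLim_eq_picardMap hρ hA hB hU hR hS1 hS2 l s k
    rw [← hc] at hfix
    rw [hfix]
    simp only [picardMap, FourierNS.clamp_of_mem hs, heatFactor_apply, hF, Complex.real_smul]
    rw [hG, ← intervalIntegral.integral_const_mul, ← intervalIntegral.integral_neg]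
    refine intervalIntegral.integral_congr fun σ _ => ?_
    simp only [Complex.real_smul, ← mul_assoc, hP, mul_neg]
    congr 1
    rw [← Complex.ofReal_mul, ← Real.exp_add, hν]
    congr 1
    ring_nf
  have key := (hF' t).hasDerivWithinAt (s := Icc 0 θ)
  rw [← hcF t ht] at key
  have key2 := key.congr (fun s hs => hcF s hs) (hcF t ht)
  have hval : -(ν : ℂ) * c l t k -
      projSym (fun j => U j t) (fun i j => RH i j t) (fun j => c j t) l k = -(ν : ℂ) * c l t k + P t := by
    simp only [hP]; ring
  rw [hval]
  exact key2

/-! ### Families: closure under the projected symbol -/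

section Family

variable {n : ℕ}

omit [DecidableEq d] in
/-- **The convective family of families is a family** (three transport families and the
differentiated forcing). [folklore] -/
theorem IsCoeffFamily.convFamily (hθ : 0 < θ) {UF : d → ℕ → ℝ → (d → ℤ) → ℂ}
    {RF : d → d → ℕ → ℝ → (d → ℤ) → ℂ} {CF : d → ℕ → ℝ → (d → ℤ) → ℂ}
    (hUF : ∀ j, IsCoeffFamily θ n (UF j)) (hRF : ∀ i j, IsCoeffFamily θ n (RF i j))
    (hCF : ∀ j, IsCoeffFamily θ n (CF j)) (l : d) : IsCoeffFamily θ n (convFamily UF RF CF l) :=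
  (((IsCoeffFamily.transportFamily hθ hCF (hCF l)).add (IsCoeffFamily.transportFamily hθ hUF (hCF l))).add
    (IsCoeffFamily.transportFamily hθ hCF (hUF l))).add
      (IsCoeffFamily.finset_sum _ fun j _ => (hRF l j).dsym j)

/-- **The projected family of families is a family** (the Leray entries are time-independent
symbols bounded by `2`). [folklore] -/
theorem IsCoeffFamily.projFamily (hθ : 0 < θ) {UF : d → ℕ → ℝ → (d → ℤ) → ℂ}
    {RF : d → d → ℕ → ℝ → (d → ℤ) → ℂ} {CF : d → ℕ → ℝ → (d → ℤ) → ℂ}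
    (hUF : ∀ j, IsCoeffFamily θ n (UF j)) (hRF : ∀ i j, IsCoeffFamily θ n (RF i j))
    (hCF : ∀ j, IsCoeffFamily θ n (CF j)) (l : d) : IsCoeffFamily θ n (projFamily UF RF CF l) :=
  IsCoeffFamily.finset_sum _ fun m _ =>
    (IsCoeffFamily.convFamily hθ hUF hRF hCF m).symbol (σ := fun k => leraySym l m k) (g := 0)
      zero_le_two fun k => by simpa using norm_leraySym_le l m k

/-- **The bootstrap right-hand side of families is a family**: `-4π²|k|² CFₗ - (P G)ₗ`. [folklore] -/
theorem IsCoeffFamily.bootRHS' (hθ : 0 < θ) {UF : d → ℕ → ℝ → (d → ℤ) → ℂ}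
    {RF : d → d → ℕ → ℝ → (d → ℤ) → ℂ} {CF : d → ℕ → ℝ → (d → ℤ) → ℂ}
    (hUF : ∀ j, IsCoeffFamily θ n (UF j)) (hRF : ∀ i j, IsCoeffFamily θ n (RF i j))
    (hCF : ∀ j, IsCoeffFamily θ n (CF j)) (l : d) : IsCoeffFamily θ n (bootRHS UF RF CF l) :=
  ((hCF l).symbol (σ := fun k => -(heatRate 1 k : ℂ)) (g := 2) (by positivity)
    (norm_heatRate_le zero_le_one)).sub (IsCoeffFamily.projFamily hθ hUF hRF hCF l)

end Family

/-! ### Families of all orders for the Picard limit -/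

/-- **Families of all orders for the Picard limit.** Let the drift and stress coefficients
`U`, `RH` be, on `[0, θ]`, the zeroth members of coefficient families `UF ⱼ`, `RF l j` of every
order (in the application: the coefficients of `∂ₜⁱuⱼ`, `∂ₜⁱRₗⱼ`). Then for every `n` the
components of the Picard limit are the zeroth members of coefficient families of order `n` on
`[0, θ]` (`∂ₜ Wᵢ = Wᵢ₊₁` within `[0, θ]`, every decay, continuity): induction on `n` via
`∂ₜ cₗ = -4π²|k|² cₗ - (P G)ₗ` and the closure `IsCoeffFamily.bootRHS'`, as
`ScalarFourier.PicardHyp.exists_coeffFamily`. [folklore] -/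
theorem DataHyp.exists_coeffFamily (h : DataHyp θ U RH) {ρ A B : ℝ} (hρ : 0 ≤ ρ)
    (hA : 0 ≤ A) (hB : 0 ≤ B) (hU : ∀ j t, HasDecay (latOrder d + 1) A (U j t))
    (hR : ∀ i j t, HasDecay (latOrder d + 1) B (RH i j t))
    (hS1 : (Real.exp 1 * (1 + 1 / (2 * Real.sqrt (4 * π ^ 2 * 1))) * Real.sqrt θ) *
      (2 * Fintype.card d *
        (Fintype.card d * (2 ^ latOrder d * latMass d * (ρ * (2 * π * ρ) + ρ * (2 * π * ρ))) +
          Fintype.card d * (2 ^ latOrder d * latMass d * (A * (2 * π * ρ) + A * (2 * π * ρ))) +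
          Fintype.card d * (2 ^ latOrder d * latMass d * (ρ * (2 * π * A) + ρ * (2 * π * A))) +
          Fintype.card d * (2 * π * B))) ≤ ρ)
    (hS2 : (Real.exp 1 * (1 + 1 / (2 * Real.sqrt (4 * π ^ 2 * 1))) * Real.sqrt θ) *
      (2 * Fintype.card d *
        (Fintype.card d * (2 ^ latOrder d * latMass d * (2 * π)) * (4 * ρ + 4 * A))) ≤ 1 / 2)
    {UF : d → ℕ → ℝ → (d → ℤ) → ℂ} {RF : d → d → ℕ → ℝ → (d → ℤ) → ℂ}
    (hUF : ∀ n j, IsCoeffFamily θ n (UF j)) (hRF : ∀ n i j, IsCoeffFamily θ n (RF i j))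
    (hU0 : ∀ j, ∀ t ∈ Icc 0 θ, UF j 0 t = U j t) (hR0 : ∀ i j, ∀ t ∈ Icc 0 θ, RF i j 0 t = RH i j t)
    (n : ℕ) :
    ∃ W : d → ℕ → ℝ → (d → ℤ) → ℂ, (∀ l, W l 0 = picardLim θ U RH l) ∧ ∀ l, IsCoeffFamily θ n (W l) := by
  obtain ⟨hcont, hball, htend, -, -⟩ := h.iter_tendsto hρ hA hB hU hR hS1 hS2
  set c := picardLim θ U RH with hc
  have base : ∀ l, IsCoeffFamily θ 0 (fun _ => c l) := fun l =>
    { decay := fun i _ K => by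
        obtain ⟨C, -, hC⟩ := h.hasDecay_picardLim_all hρ hA hU hball htend K
        exact ⟨C, fun t _ => hC l t⟩
      cont := fun i _ m => (h.continuous_picardLim hρ hA hB hU hR hS1 hS2 l m).continuousOn
      deriv := fun i hi => absurd hi (Nat.not_lt_zero i) }
  induction n with
  | zero => exact ⟨fun l _ => c l, fun l => rfl, base⟩
  | succ n ih =>
    obtain ⟨W, hW0, hW⟩ := ih
    set D : d → ℕ → ℝ → (d → ℤ) → ℂ := fun l => bootRHS UF RF W l with hD
    have hDf : ∀ l, IsCoeffFamily θ n (D l) := fun l =>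
      IsCoeffFamily.bootRHS' h.hθ (fun j => hUF n j) (fun i j => hRF n i j) hW l
    refine ⟨fun l => consFamily (c l) (D l), fun l => rfl, fun l => ?_⟩
    refine ⟨fun i hi K => ?_, fun i hi m => ?_, fun i hi m t ht => ?_⟩
    · cases i with
      | zero => exact (base l).decay 0 le_rfl K
      | succ i => exact (hDf l).decay i (by omega) K
    · cases i with
      | zero => exact (base l).cont 0 le_rfl m
      | succ i => exact (hDf l).cont i (by omega) m
    · cases i with
      | zero =>
        have hd := h.hasDerivWithinAt_picardLim hρ hA hB hU hR hS1 hS2 l m ht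
        simp only [consFamily_zero, consFamily_succ, zero_add]
        convert hd using 1
        simp only [hD, bootRHS_apply, projFamily_zero, hW0, ← hc]
        have hU' : (fun j => UF j 0 t) = fun j => U j t := funext fun j => hU0 j t ht
        have hR' : (fun i j => RF i j 0 t) = fun i j => RH i j t := by
          funext i j; exact hR0 i j t ht
        rw [hU', hR']
      | succ i =>
        simp only [consFamily_succ]
        exact (hDf l).deriv i (by omega) m t ht

end CorrectorFourier

end Literature.Analysis.FluidPDE

end
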